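import Summits.CriticalPhenomena.CardyFormulaZ2.Theses.CardySelfRefinement
import Summits.CriticalPhenomena.CardyFormulaZ2.Theorems.CardySelfRefinementLagHandOffChordal
import HarnessLib

/-!
# Limit-curve regularity for line `hitting-tournament` of crux `LagHandOff`
(stmt-CriticalPhenomena-10268): the chordal conjunct

Partial helper for the registered stub `stub_limitCurveRegularity` (namespace
`Summit.CriticalPhenomena.CardyFormulaZ2.Cruxes.LagHandOff.HittingTournament`).  Of its three
conjuncts — (1) chordality of `ν`-a.e. curve class (source `a`, target `b`, trace in `D̄`),
(2) a.s. no boundary tracing, (3) a.s. no idling inside the past range — this file proves (1),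
`stub_limitCurveRegularity_chordal`, with the stub's hypotheses verbatim.

Proof.  DISCRETE INPUT (`eventually_forall_bondInterfaceIn_near`, landed with the sibling line):
for all small meshes and EVERY configuration the interface of an admissible discretisation
family starts within `ρ` of `a`, ends within `ρ` of `b` and has its trace in the closed
`ρ`-neighbourhood of `D̄`.  LIMIT: an eventually-sure CLOSED event `F` passes to `ν`-a.e. curve
class by testing the weak convergence on the bounded continuous function `min 1 (infDist · F)`,
whose integrals vanish eventually (`ae_mem_of_tendsto_of_forall_mem`); intersect over
`ρ = 1/(k+1)`.

References: M. Aizenman, A. Burchard, Duke Math. J. 99 (1999) §2.1 (curve space; endpoints and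
traces are continuous / upper semicontinuous functionals); S. Smirnov, C. R. Acad. Sci. 333
(2001) §2 (exploration path from `a_δ` to `b_δ`).
-/

noncomputable section

open MeasureTheory Filter Set Topology
open scoped unitInterval BoundedContinuousFunction
open Literature.Probability.Percolation Literature.Probability.LatticeModels
open Literature.Probability.RandomPlanarGeometry Literature.Probability.Percolation.QuadCrossing
open Summit.CriticalPhenomena.CardyFormulaZ2.Theses.CardySelfRefinement

namespace Summit.CriticalPhenomena.CardyFormulaZ2.Cruxes.LagHandOff.HittingTournament

open Summit.CriticalPhenomena.CardyFormulaZ2.Cruxes.LagHandOff.CrosscutDictionary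
  (eventually_forall_bondInterfaceIn_near isClosed_setOf_near isClosed_setOf_chordal)

/-! ### Eventually-sure closed events pass to weak limits -/

/-- **Closed, eventually sure events pass to the weak limit.** If the laws of random elements
`X n` of a metric space converge weakly to `ν` (tested on bounded continuous functions) and a
closed set `F` contains `X n ω` for EVERY `ω` and all large `n`, then `ν`-a.e. point lies in `F`
(test on `min 1 (infDist · F)`). -/
theorem ae_mem_of_tendsto_of_forall_mem {Ω X : Type*} [MeasurableSpace Ω] {P : Measure Ω}
    [MetricSpace X] [MeasurableSpace X] [OpensMeasurableSpace X]
    {Xn : ℕ → Ω → X} {ν : Measure X} [IsFiniteMeasure ν]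
    (hlim : ∀ f : X →ᵇ ℝ, Tendsto (fun n => ∫ ω, f (Xn n ω) ∂P) atTop (𝓝 (∫ x, f x ∂ν)))
    {F : Set X} (hF : IsClosed F) (hev : ∀ᶠ n in atTop, ∀ ω, Xn n ω ∈ F) :
    ∀ᵐ x ∂ν, x ∈ F := by
  rcases F.eq_empty_or_nonempty with rfl | hne
  · rcases isEmpty_or_nonempty Ω with hΩ | hΩ
    · -- no configuration: all integrals over `P` vanish, so `ν = 0`
      have h1 := hlim 1
      have hzero : ∫ x, (1 : X →ᵇ ℝ) x ∂ν = 0 := by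
        refine tendsto_nhds_unique h1 (tendsto_const_nhds.congr' (Eventually.of_forall fun n => ?_))
        simp [integral_of_isEmpty]
      simp only [BoundedContinuousFunction.coe_one, Pi.one_apply, integral_const, smul_eq_mul,
        mul_one] at hzero
      have hν : ν = 0 := by
        rw [← Measure.measure_univ_eq_zero]
        have := hzero
        rw [measureReal_def, ENNReal.toReal_eq_zero_iff] at this
        exact this.resolve_right (measure_ne_top _ _)
      rw [hν, ae_zero]; exact eventually_bot
    · exfalso
      obtain ⟨n, hn⟩ := hev.exists
      exact hn (Classical.arbitrary Ω)
  set g : X →ᵇ ℝ := BoundedContinuousFunction.mkOfBound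
    ⟨fun x => min 1 (Metric.infDist x F), continuous_const.min (Metric.continuous_infDist_pt F)⟩
    1 (by
      intro x y
      have hx0 : 0 ≤ min 1 (Metric.infDist x F) := le_min zero_le_one Metric.infDist_nonneg
      have hx1 : min 1 (Metric.infDist x F) ≤ 1 := min_le_left _ _
      have hy0 : 0 ≤ min 1 (Metric.infDist y F) := le_min zero_le_one Metric.infDist_nonneg
      have hy1 : min 1 (Metric.infDist y F) ≤ 1 := min_le_left _ _
      rw [ContinuousMap.coe_mk, Real.dist_eq]
      exact abs_sub_le_iff.2 ⟨by linarith, by linarith⟩) with hg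
  have hg_apply : ∀ x, g x = min 1 (Metric.infDist x F) := fun x => rfl
  have hg_nonneg : ∀ x, 0 ≤ g x := fun x => le_min zero_le_one Metric.infDist_nonneg
  have hg_zero : ∀ x, g x = 0 ↔ x ∈ F := by
    intro x
    rw [hg_apply, hF.mem_iff_infDist_zero hne]
    constructor
    · intro h
      rcases min_eq_iff.1 h with ⟨h1, -⟩ | ⟨h2, -⟩
      · norm_num at h1
      · exact h2
    · intro h
      rw [h]
      exact min_eq_right zero_le_one
  have hzero : ∫ x, g x ∂ν = 0 := by
    refine tendsto_nhds_unique (hlim g) (tendsto_const_nhds.congr' ?_)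
    filter_upwards [hev] with n hn
    exact (integral_eq_zero_of_ae (Eventually.of_forall fun ω => (hg_zero _).2 (hn ω))).symm
  have hint : Integrable g ν := g.integrable ν
  have hae := (integral_eq_zero_iff_of_nonneg (fun x => hg_nonneg x) hint).1 hzero
  filter_upwards [hae] with x hx
  exact (hg_zero _).1 hx

/-! ### Conjunct (1) of `stub_limitCurveRegularity`: chordality of the limit classes -/

/-- **Conjunct (1) of `stub_limitCurveRegularity` (partial).** Along positive meshes
`δₙ → 0`, every weak limit `ν` of the interface laws of an admissible `ℤ²`-discretisation
family of `(D; a, b)` is carried by curve classes from `a = D.pt 0` to `b = D.pt 1` whose trace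
lies in `closure D`. -/
theorem stub_limitCurveRegularity_chordal :
    ∀ (D : DobrushinDomain) (E : ℝ → DiscreteDobrushin), ZdDiscretisationFamily D E →
      ∀ δs : ℕ → ℝ, (∀ n, 0 < δs n) → Tendsto δs atTop (𝓝 0) →
        ∀ (ν : Measure (CurveClass ℂ)) [IsProbabilityMeasure ν],
          (∀ f : CurveClass ℂ →ᵇ ℝ,
            Tendsto (fun n => ∫ ω, f (bondInterfaceIn D (E (δs n)) ω)
              ∂(bondPercolation (zdGraph 2) half)) atTop (𝓝 (∫ γ, f γ ∂ν))) →
          ∀ᵐ γ ∂ν, (γ.source = D.pt 0 ∧ γ.target = D.pt 1 ∧ γ.range ⊆ closure D.carrier) := by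
  intro D E hE δs hpos hlim ν _ hconv
  have hδs : Tendsto δs atTop (𝓝[>] 0) :=
    tendsto_nhdsWithin_iff.2 ⟨hlim, Eventually.of_forall hpos⟩
  have hk : ∀ k : ℕ, ∀ᵐ γ ∂ν,
      γ ∈ {γ : CurveClass ℂ | dist γ.source (D.pt 0) ≤ 1 / ((k : ℝ) + 1) ∧
        dist γ.target (D.pt 1) ≤ 1 / ((k : ℝ) + 1) ∧
        γ.range ⊆ Metric.cthickening (1 / ((k : ℝ) + 1)) (closure D.carrier)} := fun k =>
    ae_mem_of_tendsto_of_forall_mem (Xn := fun n ω => bondInterfaceIn D (E (δs n)) ω) hconv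
      (isClosed_setOf_near D _)
      (hδs.eventually (eventually_forall_bondInterfaceIn_near D hE (by positivity)))
  filter_upwards [ae_all_iff.2 hk] with γ hγ
  refine ⟨?_, ?_, ?_⟩
  · refine dist_le_zero.1 (le_of_not_gt fun h => ?_)
    obtain ⟨k, hk⟩ := exists_nat_one_div_lt h
    exact (hγ k).1.not_gt hk
  · refine dist_le_zero.1 (le_of_not_gt fun h => ?_)
    obtain ⟨k, hk⟩ := exists_nat_one_div_lt h
    exact (hγ k).2.1.not_gt hk
  · intro z hz
    rw [← closure_closure (s := D.carrier), Metric.closure_eq_iInter_cthickening]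
    simp only [Set.mem_iInter]
    intro ε hε
    obtain ⟨k, hk⟩ := exists_nat_one_div_lt hε
    exact Metric.cthickening_mono hk.le _ ((hγ k).2.2 hz)

end Summit.CriticalPhenomena.CardyFormulaZ2.Cruxes.LagHandOff.HittingTournament

end
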